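import Summits.NavierStokesRegularity.NavierStokesRegularity.Theorems.ExtremiserTransienceNearExtremalTransienceExtremiserLiouvilleConstantSpeedCalculus
import Literature.Analysis.FluidPDE.WholeSpaceIBP
import Literature.Analysis.FluidPDE.AxisymHouLiVariables
import HarnessLib

/-!
# Crux `ExtremiserTransience.NearExtremalTransience` (stmt-NavierStokesRegularity-21883), line `extremiser_liouville`,
# stub K1b — THE PIOLA SLIDE: an exactly admissible vertical deformation of the residue's far field

`--supports stmt-NavierStokesRegularity-21883` (helper).  Author: prover seat `ns-el-k1b` (g8).  Record:
`Cruxes/NearExtremalTransience/Lines/extremiser_liouville_k1b_slide.md`.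

For the K1b residue object `w = c + V` (`‖w‖ ≡ ‖c‖ = M`, `c = (0,0,c₂)`, `div V = 0`) and a height re-parametrisation
`τ : ℝ → ℝ` (think `τ(s) = s − εg(s)`, `g′ = γ ≥ 0`), the VERTICAL PIOLA SLIDE of the deviation is the field
```
  Ṽ(x) = τ′(x₂)·V(Φx) − ((τ′(x₂) − 1)·V₂(Φx))·e₂ = (τ′·V_h, V₂)(Φx),      Φ(x) = x + (τ(x₂) − x₂)·e₂
```
(the Piola transform of `V` under `x ↦ (x_h, τ(x₂))`).  Three EXACT pointwise facts make `c + Ṽ` a legal competitor in g5's convex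
KKT inequality `firstVariation_le_of_norm_add_le_global` (…ConstantSpeedConvexKKT):

* `divergence_comp_slideMap` : `div(V∘Φ)(x) = div V(Φx) + (τ′(x₂) − 1)·(∂₂V₂)(Φx)` (chain rule; components by the tree's `divergence_eq_sum_three`);
* `isDivFree_piolaSlide` : **`div Ṽ = 0`** whenever `div V = 0`;
* `norm_add_piolaSlide_sq` : **`‖c + Ṽ(x)‖² = ‖c‖² − (1 − τ′(x₂)²)·‖V_h(Φx)‖²`** whenever `⟪V, c⟫ ≡ −‖V‖²/2` (constant speed), so
  `norm_add_piolaSlide_le` : **`‖c + Ṽ(x)‖ ≤ ‖c‖` as soon as `|τ′| ≤ 1`** — the slide NEVER RAISES THE SPEED;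
* `inner_self_sub_translate_nonneg` : `⟪w(x), w(x) − w(y)⟫ ≥ 0` for a constant-speed field (Cauchy–Schwarz) — the sign fact behind the
  backward-difference-quotient version of the slide (record §1(a)).

The generator of the slide is `−(g∂₂V + g′V_h)`; its first variation is explicit and coercive (record §2), which kills every residue
JET.  WHAT THIS IS NOT: K1b is NOT proved (the flat alternative is untouched); nothing here proves NS regularity. [folklore]
-/

noncomputable section

open Set Filter Topology MeasureTheory Metric Function InnerProductSpace
open scoped ENNReal NNReal Topology InnerProductSpace RealInnerProductSpace ContDiff
open Literature.Analysis.FluidPDE Literature.Analysis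

namespace Summit.NavierStokesRegularity.NavierStokesRegularity.Theorems

-- the problem directory repeats the summit name (`NavierStokesRegularity/NavierStokesRegularity`)
set_option linter.dupNamespace false

namespace ExtremiserLiouville

open DepletionLadder.KStar

variable {V w : EuclideanSpace ℝ (Fin 3) → EuclideanSpace ℝ (Fin 3)} {c : EuclideanSpace ℝ (Fin 3)} {τ : ℝ → ℝ}

/-! ## 1. The slide map `Φ(x) = x + (τ(x₂) − x₂)e₂` and its derivative -/

/-- Derivative of the axial re-parametrisation `x ↦ τ(x₂)`: `D(τ∘x₂)(x) = τ′(x₂)·dx₂`. [folklore] -/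
theorem hasFDerivAt_comp_coord_two (hτ : Differentiable ℝ τ) (x : EuclideanSpace ℝ (Fin 3)) :
    HasFDerivAt (fun y : EuclideanSpace ℝ (Fin 3) => τ (y 2))
      (deriv τ (x 2) • (EuclideanSpace.proj (2 : Fin 3) : EuclideanSpace ℝ (Fin 3) →L[ℝ] ℝ)) x := by
  have h := (hτ (x 2)).hasDerivAt.comp_hasFDerivAt x
    (EuclideanSpace.proj (2 : Fin 3) : EuclideanSpace ℝ (Fin 3) →L[ℝ] ℝ).hasFDerivAt
  exact h

/-- Derivative of the slide map: `DΦ(x)y = y + ((τ′(x₂) − 1)·y₂)·e₂`. [folklore] -/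
theorem hasFDerivAt_slideMap (hτ : Differentiable ℝ τ) (x : EuclideanSpace ℝ (Fin 3)) :
    HasFDerivAt (fun y : EuclideanSpace ℝ (Fin 3) => y + (τ (y 2) - y 2) • EuclideanSpace.single (2 : Fin 3) (1 : ℝ))
      (ContinuousLinearMap.id ℝ (EuclideanSpace ℝ (Fin 3)) +
        ((deriv τ (x 2) - 1) • (EuclideanSpace.proj (2 : Fin 3) : EuclideanSpace ℝ (Fin 3) →L[ℝ] ℝ)).smulRight
          (EuclideanSpace.single (2 : Fin 3) (1 : ℝ))) x := by
  have h1 := hasFDerivAt_comp_coord_two hτ x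
  have h2 : HasFDerivAt (fun y : EuclideanSpace ℝ (Fin 3) => y 2)
      (EuclideanSpace.proj (2 : Fin 3) : EuclideanSpace ℝ (Fin 3) →L[ℝ] ℝ) x :=
    (EuclideanSpace.proj (2 : Fin 3) : EuclideanSpace ℝ (Fin 3) →L[ℝ] ℝ).hasFDerivAt
  have h3 : HasFDerivAt (fun y : EuclideanSpace ℝ (Fin 3) => τ (y 2) - y 2)
      (deriv τ (x 2) • (EuclideanSpace.proj (2 : Fin 3) : EuclideanSpace ℝ (Fin 3) →L[ℝ] ℝ) -
        (EuclideanSpace.proj (2 : Fin 3) : EuclideanSpace ℝ (Fin 3) →L[ℝ] ℝ)) x := h1.sub h2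
  have h4 : HasFDerivAt (fun y : EuclideanSpace ℝ (Fin 3) => (τ (y 2) - y 2) • EuclideanSpace.single (2 : Fin 3) (1 : ℝ))
      ((deriv τ (x 2) • (EuclideanSpace.proj (2 : Fin 3) : EuclideanSpace ℝ (Fin 3) →L[ℝ] ℝ) -
        (EuclideanSpace.proj (2 : Fin 3) : EuclideanSpace ℝ (Fin 3) →L[ℝ] ℝ)).smulRight
        (EuclideanSpace.single (2 : Fin 3) (1 : ℝ))) x := h3.smul_const _
  have h5 : HasFDerivAt (fun y : EuclideanSpace ℝ (Fin 3) => y + (τ (y 2) - y 2) • EuclideanSpace.single (2 : Fin 3) (1 : ℝ))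
      (ContinuousLinearMap.id ℝ (EuclideanSpace ℝ (Fin 3)) +
        (deriv τ (x 2) • (EuclideanSpace.proj (2 : Fin 3) : EuclideanSpace ℝ (Fin 3) →L[ℝ] ℝ) -
          (EuclideanSpace.proj (2 : Fin 3) : EuclideanSpace ℝ (Fin 3) →L[ℝ] ℝ)).smulRight
          (EuclideanSpace.single (2 : Fin 3) (1 : ℝ))) x := (hasFDerivAt_id x).add h4
  rw [sub_smul, one_smul]
  exact h5

/-- The slide map's derivative on the standard basis: `DΦ(x)eᵢ = eᵢ` for `i = 0,1` and `DΦ(x)e₂ = τ′(x₂)e₂`. [folklore] -/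
theorem fderiv_slideMap_single (hτ : Differentiable ℝ τ) (x : EuclideanSpace ℝ (Fin 3)) (i : Fin 3) :
    fderiv ℝ (fun y : EuclideanSpace ℝ (Fin 3) => y + (τ (y 2) - y 2) • EuclideanSpace.single (2 : Fin 3) (1 : ℝ)) x
        (EuclideanSpace.single i (1 : ℝ)) =
      EuclideanSpace.single i (1 : ℝ) +
        ((deriv τ (x 2) - 1) * (EuclideanSpace.single i (1 : ℝ) : EuclideanSpace ℝ (Fin 3)) 2) •
          EuclideanSpace.single (2 : Fin 3) (1 : ℝ) := by
  rw [(hasFDerivAt_slideMap hτ x).fderiv]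
  show EuclideanSpace.single i (1 : ℝ) +
      ((deriv τ (x 2) - 1) * (EuclideanSpace.single i (1 : ℝ) : EuclideanSpace ℝ (Fin 3)) 2) •
        EuclideanSpace.single (2 : Fin 3) (1 : ℝ) = _
  rfl

/-! ## 2. Divergence of the composition `V ∘ Φ` and of the slide -/


/-- **Chain rule for the divergence along the slide map**:
`div(V∘Φ)(x) = div V(Φx) + (τ′(x₂) − 1)·(∂₂V₂)(Φx)`. [folklore] -/
theorem divergence_comp_slideMap (hV : Differentiable ℝ V) (hτ : Differentiable ℝ τ) (x : EuclideanSpace ℝ (Fin 3)) :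
    VectorCalculus.divergence
        (fun y : EuclideanSpace ℝ (Fin 3) => V (y + (τ (y 2) - y 2) • EuclideanSpace.single (2 : Fin 3) (1 : ℝ))) x =
      VectorCalculus.divergence V (x + (τ (x 2) - x 2) • EuclideanSpace.single (2 : Fin 3) (1 : ℝ)) +
        (deriv τ (x 2) - 1) *
          fderiv ℝ V (x + (τ (x 2) - x 2) • EuclideanSpace.single (2 : Fin 3) (1 : ℝ))
            (EuclideanSpace.single (2 : Fin 3) (1 : ℝ)) 2 := by
  set Φ : EuclideanSpace ℝ (Fin 3) → EuclideanSpace ℝ (Fin 3) :=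
    fun y => y + (τ (y 2) - y 2) • EuclideanSpace.single (2 : Fin 3) (1 : ℝ) with hΦ
  have hΦd : HasFDerivAt Φ (fderiv ℝ Φ x) x := (hasFDerivAt_slideMap hτ x).differentiableAt.hasFDerivAt
  have hcomp : HasFDerivAt (fun y => V (Φ y)) ((fderiv ℝ V (Φ x)).comp (fderiv ℝ Φ x)) x :=
    (hV (Φ x)).hasFDerivAt.comp x hΦd
  rw [divergence_eq_sum_three, divergence_eq_sum_three, hcomp.fderiv]
  simp only [ContinuousLinearMap.comp_apply]
  rw [fderiv_slideMap_single hτ x 0, fderiv_slideMap_single hτ x 1, fderiv_slideMap_single hτ x 2]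
  have e0 : (EuclideanSpace.single (0 : Fin 3) (1 : ℝ) : EuclideanSpace ℝ (Fin 3)) 2 = 0 := by simp
  have e1 : (EuclideanSpace.single (1 : Fin 3) (1 : ℝ) : EuclideanSpace ℝ (Fin 3)) 2 = 0 := by simp
  have e2 : (EuclideanSpace.single (2 : Fin 3) (1 : ℝ) : EuclideanSpace ℝ (Fin 3)) 2 = 1 := by simp
  rw [e0, e1, e2]
  simp only [mul_zero, zero_smul, add_zero, mul_one]
  have hlin : fderiv ℝ V (Φ x) (EuclideanSpace.single 2 1 + (deriv τ (x 2) - 1) • EuclideanSpace.single 2 1) =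
      fderiv ℝ V (Φ x) (EuclideanSpace.single 2 1) + (deriv τ (x 2) - 1) • fderiv ℝ V (Φ x) (EuclideanSpace.single 2 1) := by
    rw [map_add, map_smul]
  rw [hlin, PiLp.add_apply, PiLp.smul_apply, smul_eq_mul]
  ring

/-- **The vertical Piola slide is divergence free.**  With `Φ(x) = x + (τ(x₂) − x₂)e₂` and `div V = 0`, the field
`Ṽ(x) = τ′(x₂)·V(Φx) − ((τ′(x₂) − 1)·V₂(Φx))·e₂` (`= (τ′V_h, V₂)∘Φ`) has `div Ṽ = 0`.  (`τ ∈ C²`.) [folklore] -/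
theorem isDivFree_piolaSlide (hV : ContDiff ℝ 1 V) (hdiv : VectorCalculus.IsDivFree V) (hτ : ContDiff ℝ 2 τ) :
    VectorCalculus.IsDivFree fun x : EuclideanSpace ℝ (Fin 3) =>
      deriv τ (x 2) • V (x + (τ (x 2) - x 2) • EuclideanSpace.single (2 : Fin 3) (1 : ℝ)) -
        ((deriv τ (x 2) - 1) * V (x + (τ (x 2) - x 2) • EuclideanSpace.single (2 : Fin 3) (1 : ℝ)) 2) •
          EuclideanSpace.single (2 : Fin 3) (1 : ℝ) := by
  set e₂ : EuclideanSpace ℝ (Fin 3) := EuclideanSpace.single (2 : Fin 3) (1 : ℝ) with he₂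
  set Φ : EuclideanSpace ℝ (Fin 3) → EuclideanSpace ℝ (Fin 3) := fun y => y + (τ (y 2) - y 2) • e₂ with hΦ
  have hVd : Differentiable ℝ V := hV.differentiable one_ne_zero
  have hτd : Differentiable ℝ τ := hτ.differentiable two_ne_zero
  have hτ'c : ContDiff ℝ 1 (deriv τ) := by
    have h2 : ContDiff ℝ (1 + 1) τ := by rw [show ((1 : WithTop ℕ∞) + 1) = 2 by norm_num]; exact hτ
    exact h2.deriv'
  have hτ'd : Differentiable ℝ (deriv τ) := hτ'c.differentiable one_ne_zero
  -- the pieces: `a(x) = τ′(x₂)`, `b(x) = τ′(x₂) − 1`, `U = V∘Φ`, `u₂ = (V∘Φ)₂`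
  set a : EuclideanSpace ℝ (Fin 3) → ℝ := fun y => deriv τ (y 2) with ha
  set U : EuclideanSpace ℝ (Fin 3) → EuclideanSpace ℝ (Fin 3) := fun y => V (Φ y) with hU
  have hΦd : Differentiable ℝ Φ := fun y => (hasFDerivAt_slideMap hτd y).differentiableAt
  have hUd : Differentiable ℝ U := hVd.comp hΦd
  have haD : ∀ y, HasFDerivAt a (deriv (deriv τ) (y 2) •
      (EuclideanSpace.proj (2 : Fin 3) : EuclideanSpace ℝ (Fin 3) →L[ℝ] ℝ)) y :=
    fun y => hasFDerivAt_comp_coord_two hτ'd y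
  have had : Differentiable ℝ a := fun y => (haD y).differentiableAt
  have hbd : Differentiable ℝ fun y => a y - 1 := had.sub_const 1
  -- the scalar `s(x) = (τ′(x₂) − 1)·U₂(x)` and its derivative along `e₂`
  set s : EuclideanSpace ℝ (Fin 3) → ℝ := fun y => (a y - 1) * U y 2 with hs
  have hU2 : ∀ y, HasFDerivAt (fun z => U z 2)
      ((EuclideanSpace.proj (2 : Fin 3) : EuclideanSpace ℝ (Fin 3) →L[ℝ] ℝ).comp (fderiv ℝ U y)) y :=
    fun y => (EuclideanSpace.proj (2 : Fin 3) : EuclideanSpace ℝ (Fin 3) →L[ℝ] ℝ).hasFDerivAt.comp y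
      (hUd y).hasFDerivAt
  have hU2d : Differentiable ℝ fun z => U z 2 := fun y => (hU2 y).differentiableAt
  have hsd : Differentiable ℝ s := hbd.mul hU2d
  intro x
  -- split `Ṽ = a•U − s•e₂`
  have hsplit : (fun y : EuclideanSpace ℝ (Fin 3) => deriv τ (y 2) • V (y + (τ (y 2) - y 2) • e₂) -
      ((deriv τ (y 2) - 1) * V (y + (τ (y 2) - y 2) • e₂) 2) • e₂) =
      fun y => a y • U y + (-1 : ℝ) • (s y • e₂) := by
    funext y; simp only [ha, hU, hs, hΦ, neg_one_smul]; abel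
  have h1d : Differentiable ℝ (fun y => a y • U y) := had.smul hUd
  have h2d : Differentiable ℝ (fun y => s y • e₂) := hsd.smul_const e₂
  rw [hsplit, divergence_add_smul h1d h2d,
    Literature.Analysis.FluidPDE.divergence_smul_apply (had x) (hUd x),
    Literature.Analysis.FluidPDE.divergence_smul_apply (hsd x) (differentiableAt_const e₂)]
  -- `div e₂ = 0`
  have hdivconst : VectorCalculus.divergence (fun _ : EuclideanSpace ℝ (Fin 3) => e₂) x = 0 := by
    rw [divergence_eq_sum_three]; simp
  rw [hdivconst, mul_zero, zero_add]
  -- `div U = (τ′ − 1)·(∂₂V₂)∘Φ`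
  have hdivU : VectorCalculus.divergence U x = (deriv τ (x 2) - 1) * fderiv ℝ V (Φ x) e₂ 2 := by
    have h := divergence_comp_slideMap hVd hτd x
    rw [hdiv (Φ x), zero_add] at h
    exact h
  -- `⟪U x, ∇a x⟫ = τ″(x₂)·U₂(x)`
  have hgrad_a : ⟪U x, gradient a x⟫ = deriv (deriv τ) (x 2) * U x 2 := by
    rw [real_inner_comm, gradient, InnerProductSpace.toDual_symm_apply, (haD x).fderiv]
    rfl
  -- `⟪e₂, ∇s x⟫ = ∂₂ s = τ″U₂ + (τ′−1)·(DU e₂)₂`, and `(DU e₂)₂ = τ′·(DV(Φx)e₂)₂`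
  have hDUe2 : fderiv ℝ U x e₂ 2 = deriv τ (x 2) * fderiv ℝ V (Φ x) e₂ 2 := by
    have hcomp : HasFDerivAt U ((fderiv ℝ V (Φ x)).comp (fderiv ℝ Φ x)) x :=
      (hVd (Φ x)).hasFDerivAt.comp x (hΦd x).hasFDerivAt
    rw [hcomp.fderiv, ContinuousLinearMap.comp_apply, he₂, fderiv_slideMap_single hτd x 2]
    have e2 : (EuclideanSpace.single (2 : Fin 3) (1 : ℝ) : EuclideanSpace ℝ (Fin 3)) 2 = 1 := by simp
    rw [e2, mul_one]
    have hlin : fderiv ℝ V (Φ x) (EuclideanSpace.single 2 1 + (deriv τ (x 2) - 1) • EuclideanSpace.single 2 1) =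
        fderiv ℝ V (Φ x) (EuclideanSpace.single 2 1) + (deriv τ (x 2) - 1) • fderiv ℝ V (Φ x) (EuclideanSpace.single 2 1) := by
      rw [map_add, map_smul]
    rw [hlin, PiLp.add_apply, PiLp.smul_apply, smul_eq_mul]
    ring
  have hgrad_s : ⟪e₂, gradient s x⟫ = deriv (deriv τ) (x 2) * U x 2 +
      (deriv τ (x 2) - 1) * (deriv τ (x 2) * fderiv ℝ V (Φ x) e₂ 2) := by
    rw [real_inner_comm, gradient, InnerProductSpace.toDual_symm_apply]
    have hb : HasFDerivAt (fun y => a y - 1) (deriv (deriv τ) (x 2) •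
        (EuclideanSpace.proj (2 : Fin 3) : EuclideanSpace ℝ (Fin 3) →L[ℝ] ℝ)) x := (haD x).sub_const 1
    have hm : HasFDerivAt (fun y => (a y - 1) * U y 2)
        ((a x - 1) • ((EuclideanSpace.proj (2 : Fin 3) : EuclideanSpace ℝ (Fin 3) →L[ℝ] ℝ).comp (fderiv ℝ U x)) +
          U x 2 • (deriv (deriv τ) (x 2) • (EuclideanSpace.proj (2 : Fin 3) : EuclideanSpace ℝ (Fin 3) →L[ℝ] ℝ))) x :=
      hb.mul (hU2 x)
    have hse : s = fun y => (a y - 1) * U y 2 := rfl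
    rw [hse, hm.fderiv]
    show (a x - 1) * (fderiv ℝ U x e₂) 2 + U x 2 * (deriv (deriv τ) (x 2) * e₂ 2) = _
    have e2 : e₂ 2 = 1 := by rw [he₂]; simp
    rw [hDUe2, e2, mul_one]
    ring
  rw [hdivU, hgrad_a, hgrad_s]
  have hax : a x = deriv τ (x 2) := rfl
  rw [hax]
  ring

/-! ## 3. The slide never raises the speed -/

/-- Algebra of the constant-speed constraint: if `c = (0,0,c₂)` and `⟪y, c⟫ = −‖y‖²/2` (i.e. `‖c + y‖ = ‖c‖`), then for every
`t ∈ ℝ` the Piola-scaled vector `t·y − ((t−1)·y₂)·e₂ = (t·y_h, y₂)` satisfies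
`‖c + (t·y − ((t−1)y₂)e₂)‖² = ‖c‖² − (1 − t²)·(‖y‖² − y₂²)`. [folklore] -/
theorem norm_add_piolaScale_sq (hc0 : c 0 = 0) (hc1 : c 1 = 0) {y : EuclideanSpace ℝ (Fin 3)}
    (hy : ⟪y, c⟫ = -(‖y‖ ^ 2 / 2)) (t : ℝ) :
    ‖c + (t • y - ((t - 1) * y 2) • EuclideanSpace.single (2 : Fin 3) (1 : ℝ))‖ ^ 2 =
      ‖c‖ ^ 2 - (1 - t ^ 2) * (‖y‖ ^ 2 - (y 2) ^ 2) := by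
  have hny : ‖y‖ ^ 2 = y 0 ^ 2 + y 1 ^ 2 + y 2 ^ 2 := by
    rw [EuclideanSpace.real_norm_sq_eq, Fin.sum_univ_three]
  have hnc : ‖c‖ ^ 2 = c 2 ^ 2 := by
    rw [EuclideanSpace.real_norm_sq_eq, Fin.sum_univ_three, hc0, hc1]; ring
  have hyc : ⟪y, c⟫ = y 2 * c 2 := by
    simp only [PiLp.inner_apply, RCLike.inner_apply, conj_trivial, Fin.sum_univ_three, hc0, hc1]
    ring
  set z : EuclideanSpace ℝ (Fin 3) := c + (t • y - ((t - 1) * y 2) • EuclideanSpace.single (2 : Fin 3) (1 : ℝ)) with hz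
  have hz0 : z 0 = t * y 0 := by
    simp [hz, hc0]
  have hz1 : z 1 = t * y 1 := by
    simp [hz, hc1]
  have hz2 : z 2 = c 2 + y 2 := by
    simp [hz]; ring
  have hnz : ‖z‖ ^ 2 = z 0 ^ 2 + z 1 ^ 2 + z 2 ^ 2 := by
    rw [EuclideanSpace.real_norm_sq_eq, Fin.sum_univ_three]
  rw [hnz, hz0, hz1, hz2, hnc, hny]
  rw [hyc, hny] at hy
  nlinarith [hy]

/-- **The vertical Piola slide never raises the speed.**  For the residue deviation `V` (`⟪V, c⟫ ≡ −‖V‖²/2`, `c = (0,0,c₂)`):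
`‖c + Ṽ(x)‖² = ‖c‖² − (1 − τ′(x₂)²)·(‖V(Φx)‖² − V₂(Φx)²)`. [folklore] -/
theorem norm_add_piolaSlide_sq (hc0 : c 0 = 0) (hc1 : c 1 = 0) (hVc : ∀ y, ⟪V y, c⟫ = -(‖V y‖ ^ 2 / 2))
    (τ : ℝ → ℝ) (x : EuclideanSpace ℝ (Fin 3)) :
    ‖c + (deriv τ (x 2) • V (x + (τ (x 2) - x 2) • EuclideanSpace.single (2 : Fin 3) (1 : ℝ)) -
        ((deriv τ (x 2) - 1) * V (x + (τ (x 2) - x 2) • EuclideanSpace.single (2 : Fin 3) (1 : ℝ)) 2) •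
          EuclideanSpace.single (2 : Fin 3) (1 : ℝ))‖ ^ 2 =
      ‖c‖ ^ 2 - (1 - deriv τ (x 2) ^ 2) *
        (‖V (x + (τ (x 2) - x 2) • EuclideanSpace.single (2 : Fin 3) (1 : ℝ))‖ ^ 2 -
          (V (x + (τ (x 2) - x 2) • EuclideanSpace.single (2 : Fin 3) (1 : ℝ)) 2) ^ 2) :=
  norm_add_piolaScale_sq hc0 hc1 (hVc _) _

/-- **Admissibility of the slide competitor**: if `|τ′| ≤ 1` everywhere then `‖c + Ṽ(x)‖ ≤ ‖c‖` for all `x`. [folklore] -/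
theorem norm_add_piolaSlide_le (hc0 : c 0 = 0) (hc1 : c 1 = 0) (hVc : ∀ y, ⟪V y, c⟫ = -(‖V y‖ ^ 2 / 2))
    (τ : ℝ → ℝ) (hτ1 : ∀ s, |deriv τ s| ≤ 1) (x : EuclideanSpace ℝ (Fin 3)) :
    ‖c + (deriv τ (x 2) • V (x + (τ (x 2) - x 2) • EuclideanSpace.single (2 : Fin 3) (1 : ℝ)) -
        ((deriv τ (x 2) - 1) * V (x + (τ (x 2) - x 2) • EuclideanSpace.single (2 : Fin 3) (1 : ℝ)) 2) •
          EuclideanSpace.single (2 : Fin 3) (1 : ℝ))‖ ≤ ‖c‖ := by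
  have h := norm_add_piolaSlide_sq hc0 hc1 hVc τ x
  set y := V (x + (τ (x 2) - x 2) • EuclideanSpace.single (2 : Fin 3) (1 : ℝ)) with hy
  have ht : deriv τ (x 2) ^ 2 ≤ 1 := by
    have := hτ1 (x 2)
    rw [← sq_abs]; nlinarith [abs_nonneg (deriv τ (x 2))]
  have hy2 : (y 2) ^ 2 ≤ ‖y‖ ^ 2 := by
    rw [EuclideanSpace.real_norm_sq_eq, Fin.sum_univ_three]; nlinarith [sq_nonneg (y 0), sq_nonneg (y 1)]
  have hsq : ‖c + (deriv τ (x 2) • y - ((deriv τ (x 2) - 1) * y 2) • EuclideanSpace.single (2 : Fin 3) (1 : ℝ))‖ ^ 2 ≤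
      ‖c‖ ^ 2 := by
    rw [h]; nlinarith
  exact (pow_le_pow_iff_left₀ (norm_nonneg _) (norm_nonneg _) two_ne_zero).1 hsq

/-! ## 4. The sign fact for backward difference quotients -/

/-- For a constant-speed field, `⟪w(x), w(x) − w(y)⟫ ≥ 0` (Cauchy–Schwarz) — so the backward difference quotient
`g(x₂)·(w(x) − w(x − he₂))/h`, `g ≥ 0`, points weakly OUTWARD and `w − ε·(…)` does not raise the speed to first order. [folklore] -/
theorem inner_self_sub_translate_nonneg {M : ℝ} (hM : ∀ x, ‖w x‖ = M) (x y : EuclideanSpace ℝ (Fin 3)) :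
    0 ≤ ⟪w x, w x - w y⟫ := by
  rw [inner_sub_right, real_inner_self_eq_norm_sq, hM x]
  have h : ⟪w x, w y⟫ ≤ ‖w x‖ * ‖w y‖ := real_inner_le_norm _ _
  rw [hM x, hM y] at h
  nlinarith

/-- The constraint side of the backward-quotient slide: `⟪w(x), g·(w(x) − w(x − h e₂))⟫ ≥ 0` for `g ≥ 0`. [folklore] -/
theorem inner_smul_self_sub_translate_nonneg {M : ℝ} (hM : ∀ x, ‖w x‖ = M) {g : ℝ} (hg : 0 ≤ g)
    (x : EuclideanSpace ℝ (Fin 3)) (h : ℝ) :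
    0 ≤ ⟪w x, g • (w x - w (x - h • EuclideanSpace.single (2 : Fin 3) (1 : ℝ)))⟫ := by
  rw [real_inner_smul_right]
  exact mul_nonneg hg (inner_self_sub_translate_nonneg hM x _)

end ExtremiserLiouville

end Summit.NavierStokesRegularity.NavierStokesRegularity.Theorems

end
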